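import Mathlib.Algebra.Order.Antidiag.FinsuppEquiv
import Mathlib.Data.Finsupp.Lex
import Mathlib.RingTheory.MvPolynomial.Homogeneous
import Mathlib.RingTheory.MvPolynomial.Tower
import Literature.Computability.AlgebraicComplexity.RazElusiveGeneral
import Literature.Computability.AlgebraicComplexity.ValiantConjecture
import Literature.Computability.AlgebraicComplexity.ValiantClassesProofs
import Literature.Computability.AlgebraicComplexity.ArithCircuitProofs
import HarnessLib

/-!
# Raz's route to lower bounds (2010, §5): `f̃`, Prop. 5.5, Cor. 5.7, and Cor. 5.8 from them

Companion to `RazElusiveGeneral.lean` (where Raz's Cor. 5.8 = Cor. 1.14 is the named fact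
`Raz2010_cor_5_8`) and `RazElusiveGeneralProofs.lean` (which derives the corrected curve
statement `Raz2010_elusive_curve` from `Raz2010_cor_5_8`). This file decomposes Cor. 5.8 along its
printed proof (Raz 2010, p. 172: "By Proposition 5.5, and Corollary 5.7, the polynomial `f̃` … is
poly(`n`)-definable, and any arithmetic circuit (over `F`) for `f̃` is of size `≥ Ω(…)`. Valiant
proved that over any field of characteristic not equal to `2`, the permanent is a complete
polynomial for the class `VNP` of poly(`n`)-definable polynomials. Hence …"):

* §5.1 and §5.3 are DEFINED: the set `M` of degree-`r` monomials in `z₁,…,zₙ`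
  (`degreeMonomials`), Raz's lexicographic bijection `h : M → [m]`, `m = C(n+r-1, r)`
  (`lexMonomial = h⁻¹`), the identification `H` of a degree-`r` form with its coefficient vector
  (`lexCoeffs`), and the polynomial `f̃ ∈ F[X, Z]` of a polynomial mapping `f : Fⁿ → F^m`
  (`razTilde`), with Prop. 5.4 (`H(f̃|_a) = f(a)`) PROVED (`lexCoeffs_razTildeAt`).
* Raz's notion "poly(`n`)-definable POLYNOMIAL" (§1.5, p. 142, the `m = 1` case that Def. 1.3
  extends to mappings) is defined (`IsPolyDefinable`) and PROVED equivalent to the tree's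
  `IsVNPFamily` for families with p-bounded variable sets (`isVNPFamily_iff_isPolyDefinable`;
  Raz, p. 142: "it belongs to the (uniform version of the) class VNP") and to Def. 1.3 with
  `m = 1` (`isPolyDefinable_iff_isPolyDefinableMap_one`).
* Prop. 5.5 (`f` poly(`n`)-definable ⇒ `f̃` poly(`n`)-definable) and Cor. 5.7 (the circuit lower
  bound for `f̃` from elusiveness of `f`, i.e. the universal-circuit argument of Props. 2.7–2.9,
  5.1–5.3, 5.6) are vendored verbatim as NAMED FACTS (`Raz2010_prop_5_5`, `Raz2010_cor_5_7`;
  nothing asserted).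
* Cor. 5.8 is then PROVED from these two facts and the tree's named fact
  `Literature.Computability.AlgebraicComplexity.isVNPComplete_perPoly` (Valiant 1979: `PER` is `VNP`-complete in characteristic
  `≠ 2`), using the discharged closure `IsPComputable.of_isPProjection_holds`
  (`ValiantClassesProofs.lean`): `Raz2010_cor_5_8_of_parts`.

## Rendering choices (each weaker than or equal to print, except for the first item)

* Standing assumptions of §5.1: "`3 ≤ r ≤ n`, and we assume for simplicity that `n` is a power
  of `2`". The power-of-`2` simplification is DROPPED here (so on this point the two facts below
  are formally stronger than the letter of §5): the printed proof of Cor. 5.8 (stated for all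
  integers `3 ≤ r ≤ n ≤ s`) applies Prop. 5.5 and Cor. 5.7 at every such `n`, the
  simplification is used in print only for index bookkeeping (the `[m'·n]` index split in the
  proof of Prop. 3.6, absent from §5), and this matches the accepted rendering of
  `Raz2010_cor_5_8`. Accordingly both facts are stated for families indexed by Raz's basic
  parameter `n` with the side conditions `3 ≤ r n ≤ n (≤ s n)` holding for all large `n`,
  exactly as in `Raz2010_cor_5_8`.
* "Any arithmetic circuit (over `F`) for `f̃` is of size `≥ Ω(s / (C(n+r'-1, r') · r³))`"
  (Cor. 5.7; all parameters are functions of `n`, §5.1/§5.4) is rendered along the family as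
  `∃ c n₀, ∀ n ≥ n₀, s n ≤ c · C(n+r'-1, r') · (r n)³ · (complexity (f̃ n) + n)`, the unprinted
  constant of `Ω` being existentially quantified. Raz's size is the number of edges of the
  circuit (§1.1, p. 138, and Def. 2.1: sum and product gates of any in-degree, edges labelled by
  field elements, leaves labelled by variables or by `1`; with the standing convention "we assume
  w.l.o.g. that the size of a circuit is larger than the number of its input variables"); a
  fan-in-two straight-line program with `L` gates computing `f̃` (the tree's `complexity`,
  `ArithCircuit.lean`: weighted sums `c•u + d•v` and products `u·v` of variables, constants and
  earlier gates) is such a circuit with at most `2L + 2` edges (a constant operand `c` becomes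
  an edge from the leaf `1` labelled `c`), of Raz-size `≤ max(2L + 2, 2n) ≤ 4 (L + n)`, so the
  printed bound for Raz's size implies the displayed one for `complexity (f̃ n) + n` (with
  another constant), which is all that is recorded.
* "Lexicographic order of monomials" (§5.1) is Mathlib's `Finsupp.Lex` order on exponent
  vectors (any fixed bijection `h` would do for the proofs; we keep Raz's choice).
* Variables of `f̃`: `Sum.inl i` is `xᵢ` and `Sum.inr i` is `zᵢ` (`F[X, Z]`, §5.3).

## References

* R. Raz, *Elusive functions and lower bounds for arithmetic circuits*, Theory of Computing 6
  (2010) 135–177: §1.5 (p. 142, poly(`n`)-definable polynomials; Def. 1.3); §2 (Def. 2.1, size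
  of a circuit-graph); §5.1 (notation `M`, `h`, `H`, p. 168); §5.3 (the polynomial `f̃`,
  Prop. 5.4, Prop. 5.5, pp. 170–171); §5.4 (Prop. 5.6, Cor. 5.7, Cor. 5.8, pp. 171–173).
* L. G. Valiant, *Completeness classes in algebra*, STOC 1979 (VNP-completeness of `PER`);
  P. Bürgisser, *Completeness and reduction in algebraic complexity theory* (2000), Thm. 2.10,
  Rem. 2.7.
-/

noncomputable section

open MvPolynomial

namespace Literature.Computability.AlgebraicComplexity

universe u v

/-! ### §5.1: degree-`r` monomials, the lexicographic bijection `h`, and the map `H` -/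

section Monomials

/-- Raz's set `M` of monomials of total degree exactly `r` in the variables `z₁, …, zₙ`, as the
finset of exponent vectors `d : Fin n →₀ ℕ` with `∑ᵢ dᵢ = r` (Raz 2010, §5.1; here via
Mathlib's `Finset.finsuppAntidiag`). [cite: Raz2010, §5.1 (p. 168)] -/
def degreeMonomials (n r : ℕ) : Finset (Fin n →₀ ℕ) :=
  (Finset.univ : Finset (Fin n)).finsuppAntidiag r

/-- Membership in `M`: the exponents sum to `r`. [cite: Raz2010, §5.1 (p. 168)] -/
theorem mem_degreeMonomials {n r : ℕ} {d : Fin n →₀ ℕ} :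
    d ∈ degreeMonomials n r ↔ ∑ i, d i = r := by
  simp [degreeMonomials, Finset.mem_finsuppAntidiag]

/-- Membership in `M` in terms of `Finsupp.degree`. [cite: Raz2010, §5.1 (p. 168)] -/
theorem mem_degreeMonomials_iff_degree {n r : ℕ} {d : Fin n →₀ ℕ} :
    d ∈ degreeMonomials n r ↔ d.degree = r := by
  rw [mem_degreeMonomials, Finsupp.degree_eq_sum]

/-- `|M| = m = C(n+r-1, r)` (Raz 2010, §5.1: "we fix `m` to be the number of monomials of
total-degree exactly `r` in `n` variables, that is, `m = C(n+r-1, r)`"; stars and bars, via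
Mathlib's `Finset.card_finsuppAntidiag_nat_eq_choose`). [cite: Raz2010, §5.1 (p. 168)] -/
theorem card_degreeMonomials (n r : ℕ) :
    (degreeMonomials n r).card = Nat.choose (n + r - 1) r := by
  rw [degreeMonomials, Finset.card_finsuppAntidiag_nat_eq_choose, Finset.card_univ,
    Fintype.card_fin]

/-- `M` as a finset of the lexicographically ordered type synonym `Lex (Fin n →₀ ℕ)`
(Raz 2010, §5.1: "the lexicographic order of monomials"). [cite: Raz2010, §5.1 (p. 168)] -/
def degreeMonomialsLex (n r : ℕ) : Finset (Lex (Fin n →₀ ℕ)) :=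
  (degreeMonomials n r).map toLex.toEmbedding

/-- Membership in the `Lex` copy of `M`. [cite: Raz2010, §5.1 (p. 168)] -/
theorem mem_degreeMonomialsLex {n r : ℕ} {d : Lex (Fin n →₀ ℕ)} :
    d ∈ degreeMonomialsLex n r ↔ ofLex d ∈ degreeMonomials n r := by
  rw [degreeMonomialsLex, Finset.mem_map_equiv, toLex_symm_eq]

/-- The `Lex` copy of `M` also has `C(n+r-1, r)` elements. [cite: Raz2010, §5.1 (p. 168)] -/
theorem card_degreeMonomialsLex (n r : ℕ) :
    (degreeMonomialsLex n r).card = Nat.choose (n + r - 1) r := by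
  rw [degreeMonomialsLex, Finset.card_map, card_degreeMonomials]

/-- Raz's `h⁻¹ : [m] → M` (Raz 2010, §5.1: "let `h : M → [m]` be the lexicographic order of
monomials"): the `j`-th monomial of degree `r` in `n` variables in increasing `Finsupp.Lex`
order (`0`-based `j`; Mathlib's `Finset.orderEmbOfFin`). [cite: Raz2010, §5.1 (p. 168)] -/
def lexMonomial (n r : ℕ) (j : Fin (Nat.choose (n + r - 1) r)) : Fin n →₀ ℕ :=
  ofLex ((degreeMonomialsLex n r).orderEmbOfFin (card_degreeMonomialsLex n r) j)

/-- `h⁻¹(j) ∈ M`. [cite: Raz2010, §5.1 (p. 168)] -/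
theorem lexMonomial_mem (n r : ℕ) (j : Fin (Nat.choose (n + r - 1) r)) :
    lexMonomial n r j ∈ degreeMonomials n r :=
  mem_degreeMonomialsLex.1 (Finset.orderEmbOfFin_mem _ _ j)

/-- The exponents of `h⁻¹(j)` sum to `r`. [cite: Raz2010, §5.1 (p. 168)] -/
theorem sum_lexMonomial (n r : ℕ) (j : Fin (Nat.choose (n + r - 1) r)) :
    ∑ i, lexMonomial n r j i = r :=
  mem_degreeMonomials.1 (lexMonomial_mem n r j)

/-- `h⁻¹(j)` has degree `r`. [cite: Raz2010, §5.1 (p. 168)] -/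
theorem degree_lexMonomial (n r : ℕ) (j : Fin (Nat.choose (n + r - 1) r)) :
    (lexMonomial n r j).degree = r :=
  mem_degreeMonomials_iff_degree.1 (lexMonomial_mem n r j)

/-- `h⁻¹` is strictly increasing for the lexicographic order (it IS the lexicographic
enumeration). [cite: Raz2010, §5.1 (p. 168)] -/
theorem lexMonomial_strictMono (n r : ℕ) : StrictMono fun j => toLex (lexMonomial n r j) :=
  fun a b hab => by
    simpa only [lexMonomial, toLex_ofLex] using
      ((degreeMonomialsLex n r).orderEmbOfFin (card_degreeMonomialsLex n r)).strictMono hab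

/-- `h⁻¹` is injective. [cite: Raz2010, §5.1 (p. 168)] -/
theorem lexMonomial_injective (n r : ℕ) : Function.Injective (lexMonomial n r) :=
  fun _ _ hab => ((degreeMonomialsLex n r).orderEmbOfFin (card_degreeMonomialsLex n r)).injective
    (ofLex.injective hab)

/-- `h⁻¹` is onto `M`: every degree-`r` monomial has an index. [cite: Raz2010, §5.1 (p. 168)] -/
theorem exists_lexMonomial_eq {n r : ℕ} {d : Fin n →₀ ℕ} (hd : d ∈ degreeMonomials n r) :
    ∃ j, lexMonomial n r j = d := by
  have h : toLex d ∈ Set.range ((degreeMonomialsLex n r).orderEmbOfFin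
      (card_degreeMonomialsLex n r)) := by
    rw [Finset.range_orderEmbOfFin, Finset.mem_coe, mem_degreeMonomialsLex]
    exact hd
  obtain ⟨j, hj⟩ := h
  exact ⟨j, by simp only [lexMonomial, hj, ofLex_toLex]⟩

variable {F : Type u} [CommSemiring F]

/-- Raz's identification `H : 𝕄 → F^m` of a form with its vector of coefficients on `M`, read
through `h` (Raz 2010, §5.1: "each coordinate of the vector in `F^m` corresponds to the
coefficient of one monomial"): `(H g)_j = coeff_{h⁻¹(j)} g`. (Defined on all of `F[z]`; Raz
applies it to degree-`r` forms.) [cite: Raz2010, §5.1 (p. 168)] -/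
def lexCoeffs (n r : ℕ) (g : MvPolynomial (Fin n) F) : Fin (Nat.choose (n + r - 1) r) → F :=
  fun j => coeff (lexMonomial n r j) g

/-- Unfolding `lexCoeffs`. [cite: Raz2010, §5.1 (p. 168)] -/
@[simp] theorem lexCoeffs_apply (n r : ℕ) (g : MvPolynomial (Fin n) F)
    (j : Fin (Nat.choose (n + r - 1) r)) : lexCoeffs n r g j = coeff (lexMonomial n r j) g :=
  rfl

end Monomials

/-! ### §5.3: the polynomial `f̃ ∈ F[X, Z]` and Prop. 5.4 -/

section Tilde

variable {F : Type u} [CommSemiring F] {n r : ℕ}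

/-- **Raz's polynomial `f̃`** (2010, §5.3): for a polynomial mapping `f = (f₁, …, f_m) : Fⁿ → F^m`,
`m = C(n+r-1, r)`, `f̃(x, z) = ∑_{j ∈ [m]} f_j(x) · h⁻¹(j)(z) ∈ F[X, Z]`, in the `2n` variables
`X = {xᵢ = Sum.inl i}` and `Z = {zᵢ = Sum.inr i}`. [cite: Raz2010, §5.3 (p. 170)] -/
def razTilde (f : Fin (Nat.choose (n + r - 1) r) → MvPolynomial (Fin n) F) :
    MvPolynomial (Fin n ⊕ Fin n) F :=
  ∑ j, rename Sum.inl (f j) * rename Sum.inr (monomial (lexMonomial n r j) 1)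

/-- `f̃|_a ∈ F[Z]`: the polynomial `f̃` after the substitution `x₁ = a₁, …, xₙ = aₙ`
(Raz 2010, §5.3, p. 171). [cite: Raz2010, §5.3 (p. 171)] -/
def razTildeAt (f : Fin (Nat.choose (n + r - 1) r) → MvPolynomial (Fin n) F) (a : Fin n → F) :
    MvPolynomial (Fin n) F :=
  aeval (Sum.elim (C ∘ a) X) (razTilde f)

/-- `f̃|_a = ∑_j f_j(a) · h⁻¹(j)` (Raz 2010, proof of Prop. 5.4).
[cite: Raz2010, Prop. 5.4 (p. 171)] -/
theorem razTildeAt_eq_sum (f : Fin (Nat.choose (n + r - 1) r) → MvPolynomial (Fin n) F)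
    (a : Fin n → F) :
    razTildeAt f a = ∑ j, monomial (lexMonomial n r j) (eval a (f j)) := by
  unfold razTildeAt razTilde
  simp only [map_sum, map_mul, aeval_rename, Sum.elim_comp_inl, Sum.elim_comp_inr,
    aeval_X_left_apply, aeval_C_comp_left, C_mul_monomial, mul_one]
  exact Finset.sum_congr rfl fun j _ => congrArg _ (congrFun (aeval_eq_eval (f := a)) (f j))

/-- The coefficient of `h⁻¹(j)` in `f̃|_a` is `f_j(a)`. [cite: Raz2010, Prop. 5.4 (p. 171)] -/
theorem coeff_lexMonomial_razTildeAt (f : Fin (Nat.choose (n + r - 1) r) → MvPolynomial (Fin n) F)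
    (a : Fin n → F) (j : Fin (Nat.choose (n + r - 1) r)) :
    coeff (lexMonomial n r j) (razTildeAt f a) = eval a (f j) := by
  rw [razTildeAt_eq_sum, coeff_sum, Finset.sum_eq_single j]
  · rw [coeff_monomial, if_pos rfl]
  · intro j' _ hj'
    rw [coeff_monomial, if_neg ((lexMonomial_injective n r).ne hj')]
  · intro h
    exact absurd (Finset.mem_univ j) h

/-- Monomials outside `M` do not occur in `f̃|_a`. [cite: Raz2010, Prop. 5.4 (p. 171)] -/
theorem coeff_razTildeAt_of_not_mem (f : Fin (Nat.choose (n + r - 1) r) → MvPolynomial (Fin n) F)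
    (a : Fin n → F) {d : Fin n →₀ ℕ} (hd : d ∉ degreeMonomials n r) :
    coeff d (razTildeAt f a) = 0 := by
  rw [razTildeAt_eq_sum, coeff_sum]
  refine Finset.sum_eq_zero fun j _ => ?_
  rw [coeff_monomial, if_neg]
  rintro rfl
  exact hd (lexMonomial_mem n r j)

/-- **Raz 2010, Prop. 5.4**, first half: `f̃|_a ∈ 𝕄`, i.e. it is a form of degree `r`
(for every `a ∈ Fⁿ`). [cite: Raz2010, Prop. 5.4 (p. 171)] -/
theorem isHomogeneous_razTildeAt (f : Fin (Nat.choose (n + r - 1) r) → MvPolynomial (Fin n) F)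
    (a : Fin n → F) : (razTildeAt f a).IsHomogeneous r := by
  rw [razTildeAt_eq_sum]
  exact IsHomogeneous.sum _ _ _ fun j _ => isHomogeneous_monomial _ (degree_lexMonomial n r j)

/-- **Raz 2010, Prop. 5.4**, second half: `H(f̃|_a) = f(a)` for every `a ∈ Fⁿ` — the
coefficient vector of `f̃|_a` on `M` (read through `h`) is the value of the polynomial mapping
`f` at `a` (`polyMapEval f a`, `Elusive.lean`). [cite: Raz2010, Prop. 5.4 (p. 171)] -/
theorem lexCoeffs_razTildeAt (f : Fin (Nat.choose (n + r - 1) r) → MvPolynomial (Fin n) F)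
    (a : Fin n → F) : lexCoeffs n r (razTildeAt f a) = polyMapEval f a := by
  funext j
  rw [lexCoeffs_apply, coeff_lexMonomial_razTildeAt, polyMapEval_apply]

end Tilde

/-! ### §1.5 (p. 142): poly(`n`)-definable polynomials = `VNP` families -/

section PolyDefinable

variable {k : Type u} [CommSemiring k] {σ : ℕ → Type v}

/-- **Raz's poly(`n`)-definable POLYNOMIALS** (2010, §1.5, p. 142, the notion that Def. 1.3
extends to mappings): "`f ∈ F[x₁, …, xₙ]` is poly(`n`)-definable iff for some `ℓ = poly(n)`,
there exists a polynomial `g ∈ F[x₁, …, xₙ, e₁, …, e_ℓ]` of degree poly(`n`), that can be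
computed by an arithmetic circuit of size poly(`n`), and such that
`f(x) = ∑_{e ∈ {0,1}^ℓ} g(x, e)`." For a family `f n ∈ k[σ n]` indexed by Raz's basic parameter
`n`, with the tree's `boolSum`, `complexity`, `IsPBounded` (cf. `IsPolyDefinableMap`, the
`m`-output version of Def. 1.3, `RazExplicit.lean`). [cite: Raz2010, §1.5 (p. 142)] -/
def IsPolyDefinable (f : ∀ n, MvPolynomial (σ n) k) : Prop :=
  ∃ (ℓ : ℕ → ℕ) (g : ∀ n, MvPolynomial (σ n ⊕ Fin (ℓ n)) k),
    IsPBounded ℓ ∧ IsPBounded (fun n => (g n).totalDegree) ∧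
      IsPBounded (fun n => complexity (g n)) ∧ ∀ n, f n = boolSum (g n)

/-- Substituting polynomials of total degree `≤ 1` does not increase the total degree (same
statement and proof as `Literature.Computability.AlgebraicComplexity.totalDegree_aeval_le_of_le_one` in
`BurgisserBooleanParts.lean`, kept private here to avoid that module's imports). [folklore] -/
private theorem totalDegree_aeval_le_of_le_one' {R : Type*} [CommSemiring R] {α τ : Type*}
    (h : α → MvPolynomial τ R) (hh : ∀ i, (h i).totalDegree ≤ 1) (g : MvPolynomial α R) :
    (aeval h g).totalDegree ≤ g.totalDegree := by
  conv_lhs => rw [g.as_sum]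
  rw [map_sum]
  refine totalDegree_finsetSum_le fun d hd => ?_
  rw [aeval_monomial, ← C_eq_algebraMap]
  refine (totalDegree_mul _ _).trans ?_
  rw [totalDegree_C, zero_add, Finsupp.prod]
  refine (totalDegree_finsetProd _ _).trans ?_
  calc ∑ i ∈ d.support, (h i ^ d i).totalDegree ≤ ∑ i ∈ d.support, d i := by
        gcongr with i
        calc (h i ^ d i).totalDegree ≤ d i * (h i).totalDegree := totalDegree_pow _ _
          _ ≤ d i * 1 := Nat.mul_le_mul_left _ (hh i)
          _ = d i := mul_one _
    _ ≤ g.totalDegree := le_totalDegree hd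

/-- The Boolean sum does not increase the total degree: `deg ∑_e g(X, e) ≤ deg g`
(Bürgisser 2000, Rem. 2.6's setting). Same statement and proof as
`Literature.Computability.AlgebraicComplexity.totalDegree_boolSum_le` (`BurgisserBooleanParts.lean`); private here, like its helper,
to avoid that module's imports (a librarian refactor could move both down to
`ValiantClasses.lean`). [cite: Burgisser2000, Def. 2.5] -/
private theorem boolSum_totalDegree_le {τ : Type v} {m : ℕ} (g : MvPolynomial (τ ⊕ Fin m) k) :
    (boolSum g).totalDegree ≤ g.totalDegree := by
  unfold boolSum
  refine totalDegree_finsetSum_le fun e _ => totalDegree_aeval_le_of_le_one' _ (fun i => ?_) g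
  rcases i with i | j
  · exact (totalDegree_monomial_le _ _).trans (by simp)
  · simp only [Sum.elim_inr]
    split_ifs <;> simp

/-- A poly(`n`)-definable family has p-bounded degree (`deg f ≤ deg g`).
[cite: Raz2010, §1.5 (p. 142)] -/
theorem IsPolyDefinable.isPBounded_totalDegree {f : ∀ n, MvPolynomial (σ n) k}
    (hf : IsPolyDefinable f) : IsPBounded fun n => (f n).totalDegree := by
  obtain ⟨ℓ, g, -, hdeg, -, hfg⟩ := hf
  exact hdeg.mono fun n => by rw [hfg n]; exact boolSum_totalDegree_le _

variable [∀ n, Fintype (σ n)]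

/-- **poly(`n`)-definable ⇒ `VNP`** (Raz 2010, p. 142: a poly(`n`)-definable polynomial
"belongs to the (uniform version of the) class VNP"; Bürgisser 2000, Def. 2.5): for a family in
p-bounded many variables, Raz's data `(ℓ, g)` is exactly a `VP` witness family for
`IsVNPFamily`. [cite: Raz2010, §1.5 (p. 142)] -/
theorem IsPolyDefinable.isVNPFamily {f : ∀ n, MvPolynomial (σ n) k} (hf : IsPolyDefinable f)
    (hσ : IsPBounded fun n => Fintype.card (σ n)) : IsVNPFamily f := by
  have hfdeg := hf.isPBounded_totalDegree
  obtain ⟨ℓ, g, hℓ, hdeg, hcx, hfg⟩ := hf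
  refine ⟨⟨hσ, hfdeg⟩, ℓ, g, ⟨⟨?_, hdeg⟩, hcx⟩, hfg⟩
  have hcard : (fun n => Fintype.card (σ n ⊕ Fin (ℓ n))) = fun n => Fintype.card (σ n) + ℓ n := by
    funext n
    rw [Fintype.card_sum, Fintype.card_fin]
  rw [hcard]
  exact IsPBounded.add_holds hσ hℓ

/-- **`VNP` ⇒ poly(`n`)-definable** (Bürgisser 2000, Def. 2.5 and Rem. 2.6: the length of the
Boolean sum of a `VNP` family is p-bounded, being at most the number of variables of the `VP`
witness). [cite: Burgisser2000, Def. 2.5] -/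
theorem IsVNPFamily.isPolyDefinable {f : ∀ n, MvPolynomial (σ n) k} (hf : IsVNPFamily f) :
    IsPolyDefinable f := by
  obtain ⟨-, u, g, ⟨⟨hcard, hdeg⟩, hcx⟩, hfg⟩ := hf
  refine ⟨u, g, hcard.mono fun n => ?_, hdeg, hcx, hfg⟩
  rw [Fintype.card_sum, Fintype.card_fin]
  exact Nat.le_add_left _ _

/-- `VNP` families are exactly the poly(`n`)-definable families in p-bounded many variables
(Raz 2010, p. 142; Bürgisser 2000, Def. 2.5). [cite: Raz2010, §1.5 (p. 142)] -/
theorem isVNPFamily_iff_isPolyDefinable (f : ∀ n, MvPolynomial (σ n) k) :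
    IsVNPFamily f ↔ (IsPBounded fun n => Fintype.card (σ n)) ∧ IsPolyDefinable f :=
  ⟨fun h => ⟨h.1.1, h.isPolyDefinable⟩, fun h => h.2.isVNPFamily h.1⟩

end PolyDefinable

section DefOneThree

variable {k : Type u} [CommSemiring k] {σ : ℕ → Type v}

/-- Raz's bit substitution `g(x, e, w) ↦ g(x, e, bits(i))` (Def. 1.3) is a Valiant projection:
variables go to variables and each `w_t` to the constant `0` or `1`
(Bürgisser 2000, Def. 2.6(1)). [cite: Raz2010, Def. 1.3] -/
theorem isProjection_bitSubst (n ℓ K i : ℕ) (p : MvPolynomial ((σ n ⊕ Fin ℓ) ⊕ Fin K) k) :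
    IsProjection (bitSubst n ℓ K i p) p := by
  refine ⟨Sum.elim X fun t => if i.testBit t then 1 else 0, fun v => ?_, rfl⟩
  rcases v with v | t
  · exact Or.inl ⟨v, rfl⟩
  · by_cases h : i.testBit t
    · exact Or.inr ⟨1, by simp [h]⟩
    · exact Or.inr ⟨0, by simp [h]⟩

/-- **Def. 1.3 extends the polynomial notion** (Raz 2010, p. 142: "we extend the notion of
poly(`n`)-definability to polynomial mappings"): a family of single polynomials is
poly(`n`)-definable in the sense of §1.5 (`IsPolyDefinable`) iff, viewed as a family of
`1`-output mappings (`k = ⌈log₂ 1⌉ = 0` index variables `w`), it is poly(`n`)-definable in the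
sense of Def. 1.3 (`IsPolyDefinableMap`, `RazExplicit.lean`). The two witnesses differ by the
empty block of `w`-variables (a renaming one way, a projection the other way; complexity by
`complexity_rename_of_injective_holds` and `complexity_le_of_isProjection`).
[cite: Raz2010, §1.5 (p. 142), Def. 1.3] -/
theorem isPolyDefinable_iff_isPolyDefinableMap_one (f : ∀ n, MvPolynomial (σ n) k) :
    IsPolyDefinable f ↔
      IsPolyDefinableMap (m := fun _ => 1) (σ := σ) fun n (_ : Fin 1) => f n := by
  constructor
  · rintro ⟨ℓ, g, hℓ, hdeg, hcx, hfg⟩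
    refine ⟨ℓ, fun n => rename Sum.inl (g n), hℓ, hdeg.mono fun n => totalDegree_rename_le _ _,
      hcx.mono fun n => (complexity_rename_of_injective_holds Sum.inl_injective (g n)).le,
      fun n i => ?_⟩
    show f n = boolSum (bitSubst n (ℓ n) (Nat.clog 2 1) i (rename Sum.inl (g n)))
    rw [hfg n]
    congr 1
    simp only [bitSubst, aeval_rename, Sum.elim_comp_inl, aeval_X_left_apply]
  · rintro ⟨ℓ, g, hℓ, hdeg, hcx, hfg⟩
    refine ⟨ℓ, fun n => bitSubst n (ℓ n) (Nat.clog 2 1) (0 : ℕ) (g n), hℓ,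
      hdeg.mono fun n => ?_, hcx.mono fun n => ?_, fun n => ?_⟩
    · show (bitSubst n (ℓ n) (Nat.clog 2 1) 0 (g n)).totalDegree ≤ (g n).totalDegree
      unfold bitSubst
      refine totalDegree_aeval_le_of_le_one' _ (fun v => ?_) (g n)
      rcases v with v | t
      · exact (totalDegree_monomial_le _ _).trans (by simp)
      · simp only [Sum.elim_inr]
        split_ifs <;> simp
    · exact complexity_le_of_isProjection (isProjection_bitSubst _ _ _ _ _)
    · simpa using hfg n ⟨0, Nat.one_pos⟩

end DefOneThree

/-! ### Prop. 5.5 and Cor. 5.7 as named facts -/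

section NamedFacts

/-! Both statements are named facts (nothing asserted); the field `F` is a section variable so
that each is a closed `def … : Prop`. Parameters follow `Raz2010_cor_5_8`: `r s : ℕ → ℕ` are
functions of the basic parameter `n`, `f n : Fin (C(n + r n - 1, r n)) → F[x₁…xₙ]` is the
polynomial mapping `Fⁿ → F^m`, and `razTilde (f n) ∈ F[X, Z]` is its polynomial `f̃` (§5.3). -/

variable (F : Type u) [Field F]

/-- **Raz 2010, Proposition 5.5**, verbatim: "If `f = (f₁, …, f_m)` is poly(`n`)-definable (see
Definition 1.3), then the polynomial `f̃ ∈ F[X, Z]` is poly(`n`)-definable." (Proof in print: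
"Similar to the proof of Proposition 3.6", i.e. a poly(`n`)-size Boolean circuit producing a
description of the monomial `h⁻¹(j)` from the bits of `j`, made into a `VNP`-style witness by
Cook–Levin arithmetisation.) Setting of §5.1: `3 ≤ r ≤ n`, `m = C(n+r-1, r)` (and "for
simplicity `n` is a power of `2`"; the printed proof of Cor. 5.8 uses the statement at every
`n`, and so it is stated here along families with the side condition for all large `n`).
Explicitness of `f` is `IsPolyDefinableMap` (Def. 1.3, bounds polynomial in `n`, not in `m`);
the conclusion is Raz's poly(`n`)-definability of the single polynomial `f̃` (`IsPolyDefinable`,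
p. 142; equivalently `f̃ ∈ VNP`, `isVNPFamily_iff_isPolyDefinable`). Users take
`(h : Raz2010_prop_5_5 F)`. [cite: Raz2010, Prop. 5.5 (p. 171); §1.5 (p. 142), Def. 1.3] -/
def Raz2010_prop_5_5 : Prop :=
  ∀ (r : ℕ → ℕ) (f : ∀ n : ℕ, Fin (Nat.choose (n + r n - 1) (r n)) → MvPolynomial (Fin n) F),
    (∃ n₀ : ℕ, ∀ n ≥ n₀, 3 ≤ r n ∧ r n ≤ n) →
      IsPolyDefinableMap (m := fun n => Nat.choose (n + r n - 1) (r n)) (σ := fun n => Fin n) f →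
        IsPolyDefinable (σ := fun n => Fin n ⊕ Fin n) fun n => razTilde (n := n) (r := r n) (f n)

/-- **Raz 2010, Corollary 5.7**, verbatim: "Let `3 ≤ r ≤ n ≤ s`, and `m = C(n+r-1, r)` be
integers. Let `r' = ⌊2r/3⌋`. Let `f : Fⁿ → F^m` be a polynomial mapping. If over some field
extension `G ⊇ F`, `f` is `(s, 2)`-elusive (see Definition 1.1), then any arithmetic circuit
(over `F`) for the polynomial `f̃ : F^{2n} → F` (explicitly defined from `f` in Subsection 5.3),
is of size `≥ Ω(s / (C(n+r'-1, r') · r³))`." This is the universal-circuit argument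
(Props. 2.7–2.9, 5.1–5.3, 5.6). Rendering (see the module docstring): parameters as functions
of `n` with the side conditions and the elusiveness hypothesis for all large `n`, exactly as in
`Raz2010_cor_5_8`; the `Ω`-bound, transferred to the tree's `complexity` (a fan-in-two
straight-line program with `L` gates is a circuit-graph with `≤ 2L + 2` edges in the sense of
§1.1/Def. 2.1, and Raz's standing convention (§1.1, p. 138) that "the size of a circuit is
larger than the number of its input variables", here `2n`, is accounted for by the summand
`+ n`; so Raz's bound implies this one) and with its unprinted constant existentially
quantified, reads `s n ≤ c · C(n+r'-1, r') · (r n)³ · (complexity (f̃ n) + n)` for all large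
`n`. Users take `(h : Raz2010_cor_5_7 F)`.
[cite: Raz2010, Cor. 5.7 (p. 172); Prop. 5.6, §1.1 (p. 138), Def. 2.1] -/
def Raz2010_cor_5_7 : Prop :=
  ∀ (r s : ℕ → ℕ) (f : ∀ n : ℕ, Fin (Nat.choose (n + r n - 1) (r n)) → MvPolynomial (Fin n) F),
    (∃ n₀ : ℕ, ∀ n ≥ n₀, 3 ≤ r n ∧ r n ≤ n ∧ n ≤ s n) →
      (∃ n₀ : ℕ, ∀ n ≥ n₀, ∃ (G : Type u) (_ : Field G) (_ : Algebra F G),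
          IsElusive (fun i => MvPolynomial.map (algebraMap F G) (f n i)) (s n) 2) →
        ∃ c n₀ : ℕ, ∀ n ≥ n₀,
          s n ≤ c * Nat.choose (n + 2 * r n / 3 - 1) (2 * r n / 3) * r n ^ 3 *
            (complexity (razTilde (n := n) (r := r n) (f n)) + n)

end NamedFacts

/-! ### Cor. 5.8 from Prop. 5.5, Cor. 5.7 and Valiant's completeness of the permanent -/

section Assembly

/-- Arithmetic of the final comparison: `c · n³ · (n^{c₁} + c₁) < n^{c₁ + 5}` for all large `n`.
[folklore] -/
theorem eventually_mul_cube_mul_lt_pow (c c₁ : ℕ) :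
    ∃ N : ℕ, ∀ n ≥ N, c * (n ^ 3 * (n ^ c₁ + c₁)) < n ^ (c₁ + 5) := by
  refine ⟨2 * c + c₁ + 2, fun n hn => ?_⟩
  have hn1 : 1 ≤ n := by omega
  have hn2 : 2 ≤ n := by omega
  have hc₁ : c₁ ≤ n ^ c₁ := ((Nat.lt_pow_self hn2).le).trans' (le_refl _)
  calc c * (n ^ 3 * (n ^ c₁ + c₁)) ≤ c * (n ^ 3 * (2 * n ^ c₁)) := by gcongr; omega
    _ = 2 * c * n ^ (c₁ + 3) := by ring
    _ < n * n ^ (c₁ + 3) := (Nat.mul_lt_mul_right (pow_pos (by omega : 0 < n) _)).2 (by omega)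
    _ = n ^ (c₁ + 4) := by ring
    _ ≤ n ^ (c₁ + 5) := Nat.pow_le_pow_right hn1 (by omega)

/-- **Raz 2010, Cor. 5.8 (= Cor. 1.14) from its printed ingredients**: Prop. 5.5
(`Raz2010_prop_5_5`), Cor. 5.7 (`Raz2010_cor_5_7`) and Valiant's `VNP`-completeness of the
permanent in characteristic `≠ 2` (`Literature.Computability.AlgebraicComplexity.isVNPComplete_perPoly`) imply `Raz2010_cor_5_8`.
The proof is the printed one (p. 172–173): `f̃` is a `VNP` family (Prop. 5.5 and
`IsPolyDefinable.isVNPFamily`), hence a p-projection of `PER` (completeness), so p-computability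
of `PER` would make `n ↦ L(f̃ n) + n` p-bounded (`IsPComputable.of_isPProjection_holds`:
projections are free), contradicting the lower bound of Cor. 5.7 combined with the growth hypothesis
`s / C(n+r'-1, r') ≥ n^{ω(1)}` and `r ≤ n`. Composed with `Raz2010_elusive_curve_of_cor_5_8`
(`RazElusiveGeneralProofs.lean`) this also yields the corrected curve statement
`Raz2010_elusive_curve` from the same three facts. [cite: Raz2010, Cor. 5.8 (p. 172), proof] -/
theorem Raz2010_cor_5_8_of_parts {F : Type u} [Field F] (h55 : Raz2010_prop_5_5 F)
    (h57 : Raz2010_cor_5_7 F) (hV : Literature.Computability.AlgebraicComplexity.isVNPComplete_perPoly F) : Raz2010_cor_5_8 F := by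
  intro hchar r s f hpar hgrow hexp hel hper
  -- Prop. 5.5: `f̃` is poly(n)-definable, hence a `VNP` family (in `2n` variables).
  have hpar' : ∃ n₀ : ℕ, ∀ n ≥ n₀, 3 ≤ r n ∧ r n ≤ n := by
    obtain ⟨n₀, h⟩ := hpar
    exact ⟨n₀, fun n hn => ⟨(h n hn).1, (h n hn).2.1⟩⟩
  have hdef : IsPolyDefinable (σ := fun n => Fin n ⊕ Fin n)
      fun n => razTilde (n := n) (r := r n) (f n) := h55 r f hpar' hexp
  have hcard : IsPBounded fun n => Fintype.card (Fin n ⊕ Fin n) := by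
    have h : (fun n => Fintype.card (Fin n ⊕ Fin n)) = fun n => _root_.id n + _root_.id n := by
      funext n
      rw [Fintype.card_sum, Fintype.card_fin]
      rfl
    rw [h]
    exact IsPBounded.add_holds IsPBounded.id IsPBounded.id
  have hvnp : IsVNPFamily (σ := fun n => Fin n ⊕ Fin n)
      fun n => razTilde (n := n) (r := r n) (f n) := hdef.isVNPFamily hcard
  -- Valiant: `f̃` (renamed to `Fin (n + n)` variables) is a p-projection of `PER`.
  have hvnp' : IsVNPFamily fun n => renameEquiv F finSumFinEquiv
      (razTilde (n := n) (r := r n) (f n)) :=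
    (isVNPFamily_renameEquiv_iff (σ := fun n => Fin n ⊕ Fin n) (fun n => finSumFinEquiv) _).2 hvnp
  have hproj : IsPProjection (fun n => renameEquiv F finSumFinEquiv
      (razTilde (n := n) (r := r n) (f n))) (fun N => perPoly (Fin N) F) :=
    (hV hchar).2 (fun n => n + n) _ hvnp'
  -- If `PER` were p-computable, `n ↦ L(f̃ n)` would be p-bounded.
  have hcomp : IsPComputable fun n => renameEquiv F finSumFinEquiv
      (razTilde (n := n) (r := r n) (f n)) :=
    IsPComputable.of_isPProjection_holds hproj hper
  have hL : IsPBounded fun n => complexity (razTilde (n := n) (r := r n) (f n)) :=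
    IsPBounded.mono hcomp fun n => (complexity_renameEquiv_holds _ _).symm.le
  obtain ⟨c₁, hc₁⟩ : IsPBounded fun n => complexity (razTilde (n := n) (r := r n) (f n)) + n :=
    IsPBounded.add_holds hL IsPBounded.id
  -- Cor. 5.7 and the growth hypothesis.
  obtain ⟨c, n₁, hlow⟩ := h57 r s f hpar hel
  obtain ⟨n₂, hgr⟩ := hgrow (c₁ + 5)
  obtain ⟨n₀, hp⟩ := hpar
  obtain ⟨N, hN⟩ := eventually_mul_cube_mul_lt_pow c c₁
  have key : ∀ n, n₀ ≤ n → n₁ ≤ n → n₂ ≤ n → N ≤ n → False := by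
    intro n h0 h1 h2 h3
    obtain ⟨h3r, hrn, -⟩ := hp n h0
    have hC : 0 < Nat.choose (n + 2 * r n / 3 - 1) (2 * r n / 3) := Nat.choose_pos (by omega)
    have hle : n ^ (c₁ + 5) * Nat.choose (n + 2 * r n / 3 - 1) (2 * r n / 3) ≤
        c * (n ^ 3 * (n ^ c₁ + c₁)) * Nat.choose (n + 2 * r n / 3 - 1) (2 * r n / 3) :=
      calc n ^ (c₁ + 5) * Nat.choose (n + 2 * r n / 3 - 1) (2 * r n / 3) ≤ s n := hgr n h2
        _ ≤ c * Nat.choose (n + 2 * r n / 3 - 1) (2 * r n / 3) * r n ^ 3 *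
              (complexity (razTilde (n := n) (r := r n) (f n)) + n) := hlow n h1
        _ ≤ c * Nat.choose (n + 2 * r n / 3 - 1) (2 * r n / 3) * n ^ 3 * (n ^ c₁ + c₁) :=
            Nat.mul_le_mul (Nat.mul_le_mul_left _ (Nat.pow_le_pow_left hrn 3)) (hc₁ n)
        _ = c * (n ^ 3 * (n ^ c₁ + c₁)) * Nat.choose (n + 2 * r n / 3 - 1) (2 * r n / 3) := by
            ring
    exact absurd (Nat.le_of_mul_le_mul_right hle hC) (not_le.2 (hN n h3))
  exact key (n₀ + n₁ + n₂ + N) (by omega) (by omega) (by omega) (by omega)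

end Assembly

end Literature.Computability.AlgebraicComplexity
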